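import Summits.QuantumFields.YangMills.Theorems.BalabanUVNodesN08PartialIteratesSufficiency
import Summits.QuantumFields.YangMills.Theorems.BalabanUVNodesN08TrivialHistoryDominates

/-!
# BalabanUVNodes ∕ N08 — NECESSITY OF (a)′∀: every PARTIAL iterated push-forward of Haar under [Balaban1985Averaging] (15), `(Ū_{k−1}∘⋯∘Ū_j)_*dU_j` (ALL start levels `j ≤ k`),
# is dominated by the trivial history's mass measure `m_k(triv,·)·dU_k` — so the [B10] slot's mass letter FORCES (a)′∀, and (file 27) (a)′∀ gives it back up to `log(k+1)`:
# THE BRACKET CLOSES — «letter ⟺ (a)′∀ modulo `log(k+1)`»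

Track A, DAG node N08 = T. Bałaban, CMP **102** (1985) 255–275 [Balaban1985UV3]: (41) p. 266 (the history masses), (47) p. 267 (the trivial term), (2) p. 256 («ρ_{k+1} = Tρ_k»), Thm 1
(5) p. 257 (bounds extensive in `|T₁^{(k)}|`); [Balaban1985Averaging] (10) + (15) p. 19.  Cell `pub-ymgap`, width seat `pub-ymgap-dag-n08-w1` (g6), W-SEAT-START-LIST §n08 item 1
successor piece (o24) = file 30; `--supports` K1⁹ `StabilityBRunRowsAtRecordR13SepCoPHV` (stmt-QuantumFields-27364, KEY MAP v2; helper).  Companion of files 25 (necessity of (a)′ = the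
start-level-`0` iterate), 27 (`…N08PartialIteratesSufficiency`: all partial iterates `≤ C·dU_k` ⇒ every mass `≤ 1 + k·C` a.e.) and 28 (`…N08TrivialHistoryDominates`: `m_k(h,·) ≤
m_k(triv,·)` a.e.; `ν♯_k = (m_k(triv,·) − 1)·dU_k`).

THE POINT.  File 25 showed that the mass letter at the trivial history forces (a)′: `(Ū_{k−1}∘⋯∘Ū_0)_*dU_0 ≤ e^{c_m|T₁^{(k)}|}·dU_k` (start level `0`).  File 27's converse needs the
bound for ALL start levels `j < k`.  Here the gap between the two is closed on the necessity side: for ANY weakly-closed family `ν` (`(dU_k + ν_k)∘Ū_k⁻¹ ≤ dU_{k+1} + ν_{k+1}`), every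
partial iterate obeys `ι_{j,k} ≤ dU_k + ν_k` (§1: `ι_{j,j} = dU_j ≤ dU_j + ν_j`, then transport) — at the least family `ν♯ = (m_k(triv,·) − 1)·dU_k` (file 28 §2) this reads
**`(Ū_{k−1}∘⋯∘Ū_j)_*dU_j ≤ m_k(triv,·)·dU_k` for all `j ≤ k`** (§2), so the letter «`m_k(triv,·) ≤ e^{c}` a.e.» forces «`ι_{j,k} ≤ e^{c}·dU_k` for every `j ≤ k`» = (a)′∀ at level `k`.
With file 27: **letter (level `k`, constant `c`) ⟹ (a)′∀ (levels `≤ k`, constants `c`) ⟹ letter (level `k`, constant `c + log(k+1)`) for every history** (§3).  So in the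
GLOBAL-transport AC bookkeeping the node's transport input is EQUIVALENT, up to the additive `log(k+1)` in the exponent (the floors; `|T₁^{(k)}| ≥ 1` absorbs it only while
`log(K+1) ≲ c_m`), to a statement about ITERATED PUSH-FORWARDS OF HAAR ALONE — no masses, no histories, no floor.

WHAT THIS FILE PROVES (kernel; theorems only, 0 def; [folklore] measure theory; nothing of the paper asserted).  For ANY averaging family with `AvgAC`, ANY thresholds:
* §1 ★★ `partialIterates_le_add_of_weakClosed` — weakly closed `ν` (`k < K̄`) ⇒ `ι_{j,k} ≤ dU_k + ν_k` (`j ≤ k ≤ K̄`) for every family of partial iterates `ι` (file 27's hypotheses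
  `ι_{j,j} = dU_j`, `ι_{j,k+1} = ι_{j,k}∘Ū_k⁻¹`).
* §2 ★★★ `partialIterates_le_withDensity_massRecAC_triv` — **`ι_{j,k} ≤ m_k(triv,·)·dU_k`** (`j ≤ k ≤ m + K + 1`; §1 at `ν♯` + file 28 §2); ★★★ `partialIterates_le_smul_of_massBound_triv`
  — NECESSITY OF (a)′∀: «`m_k(triv,·) ≤ e^{c}` a.e.» ⇒ «`ι_{j,k} ≤ e^{c}·dU_k`, all `j ≤ k`»; `partialIterates_le_smul_of_massBound` (from the letter at any history family — it
  contains `triv`).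
* §3 ★★ `massRecAC_le_ae_of_massBound_triv_levels` — THE BRACKET: the letter at the trivial history at all levels `k′ ≤ k` with profile `c` ⇒ `m_k(h,·) ≤ (k+1)·e^{c_k}` a.e. for every
  `h` … (trivially weaker than file 28 §1's `≤ e^{c_k}`; displayed only to show the loop closes through (a)′∀: `…_via_partialIterates`);
  ★ `massRecAC_le_exp_ae_of_partialIterates_le_of_log_le` — (a)′∀ with profile `c` + slack `δ_k ≥ log(k+1)` ⇒ the letter with `c_k + δ_k`, every history.
* §4 at the [B10] slot's averaging `avOfPrint N S` on `SU(N)`: `partialIterates_avOfPrint_le_withDensity_triv`, ★★★ `partialIterates_avOfPrint_le_smul_of_massBound_triv`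
  (**the slot's letter at `triv`, level `k ≤ K`, forces `(Ū_{k−1}∘⋯∘Ū_j)_*dU_j ≤ e^{c_m|T₁^{(k)}|}·dU_k` for every `j ≤ k`**), `massRecAC_avOfPrint_le_exp_ae_of_partialIterates_le_of_log_le`
  ((a)′∀ at `c_m` + `log(k+1) ≤ c″|T₁^{(k)}|` ⇒ the letter at `c_m + c″`, every history).

LOCATED READING (R4¹², count-neutral; owners decide).  After files 28–30 the [B10] transport residual in AC currency has three equivalent-up-to-`log(k+1)` faces: (F) the floored
Haar iterate `f_k ≤ e^{c_m|T₁^{(k)}|}` a.e. (exact: necessary and sufficient); (P) (a)′∀: all partial iterated push-forwards of Haar `≤ e^{c}·dU_k` (necessary; sufficient with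
`c + log(k+1)`); (N) file 17's `dν♯_k∕dU_k ≤ e^{c} − 1` (= (F)).  (a)′ of file 25 is (P) at `j = 0` only.  Nothing here decides any of them for (15).

HONEST FRAMING: count-neutral helper; (a)′∀ ∕ (a)′ ∕ E6′ NOT decided; `hmass` NOT supplied; `PrintedUV3V` NOT proved; N08 NOT discharged; one finite 𝕋⁴ programme at fixed ε,
Bałaban AS PRINTED — R4 closes the conditional finite-𝕋⁴ rung `BalabanLadder.UV` only; the Yang–Mills mass gap (Clay) is NOT proved by any of this; nothing continuum ∕ ℝ⁴ ∕ OS.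
No `sorry`, standard axioms.
-/

noncomputable section

open MeasureTheory
open scoped ENNReal

namespace Summit.QuantumFields.YangMills.BalabanUVNodes.N08PartialIteratesNecessity

open Literature.MathematicalPhysics.QuantumFieldTheory.Balaban1983to89
open Summit.QuantumFields.Balaban3D.Carriers
open Summit.QuantumFields.Balaban3D.Proofs.MassesAC
open Summit.QuantumFields.YangMills.BalabanUVNodes.N08MassesACDominated (rnDeriv_le_of_le_withDensity)
open Summit.QuantumFields.YangMills.BalabanUVNodes.N08MassesACLeastClosedFamily (exists_excessRec weakClosed_of_excessRec)
open Summit.QuantumFields.YangMills.BalabanUVNodes.N08PartialIteratesSufficiency (massRecAC_le_exp_mul_ae_of_partialIterates_le exists_partialIterates)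
open Summit.QuantumFields.YangMills.BalabanUVNodes.N08TrivialHistoryDominates (withDensity_massRecAC_triv_eq_add_excessRec massRecAC_le_ae_of_triv_le_ae)

/-! ## §1 Partial iterates are dominated by every weakly-closed family -/
section WeakClosed

variable {P : Params} {G : Type} [GaugeGroup G] [MeasurableSpace G] [HaarData G] {av : ∀ j, Averaging P j G} (hmeas : ∀ j, Measurable (av j).avg)
include hmeas

/-- ★★ **EVERY PARTIAL ITERATED PUSH-FORWARD OF THE REFERENCE MEASURE IS DOMINATED BY EVERY WEAKLY-CLOSED FAMILY**: if `(dU_k + ν_k)∘Ū_k⁻¹ ≤ dU_{k+1} + ν_{k+1}` for `k < K̄` and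
`ι_{j,j} = dU_j`, `ι_{j,k+1} = ι_{j,k}∘Ū_k⁻¹` (`j ≤ k`), then `ι_{j,k} ≤ dU_k + ν_k` for all `j ≤ k ≤ K̄` (start: `dU_j ≤ dU_j + ν_j`; step: `Measure.map_mono` and the closure).  Only
measurability of `Ū` is used. [cite: Balaban1985UV3, (2) p.256 (bookkeeping); Balaban1985Averaging, (10) p.19] -/
theorem partialIterates_le_add_of_weakClosed (ι : ∀ j k : ℕ, Measure (GaugeField P k G)) (hι0 : ∀ j, ι j j = fieldMeasure P j G)
    (hιs : ∀ j k, j ≤ k → ι j (k + 1) = (ι j k).map (av k).avg) (Kt : ℕ) (ν : ∀ k, Measure (GaugeField P k G))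
    (hstep : ∀ k, k < Kt → (fieldMeasure P k G + ν k).map (av k).avg ≤ fieldMeasure P (k + 1) G + ν (k + 1)) :
    ∀ k, k ≤ Kt → ∀ j, j ≤ k → ι j k ≤ fieldMeasure P k G + ν k
  | 0, _, j, hj => by
    obtain rfl : j = 0 := Nat.le_zero.1 hj
    rw [hι0]; exact Measure.le_add_right le_rfl
  | k + 1, hk, j, hj => by
    by_cases hjk : j = k + 1
    · subst hjk; rw [hι0]; exact Measure.le_add_right le_rfl
    · have hj' : j ≤ k := by omega
      rw [hιs j k hj']
      calc (ι j k).map (av k).avg ≤ (fieldMeasure P k G + ν k).map (av k).avg :=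
            Measure.map_mono (partialIterates_le_add_of_weakClosed ι hι0 hιs Kt ν hstep k (by omega) j hj') (hmeas k)
        _ ≤ fieldMeasure P (k + 1) G + ν (k + 1) := hstep k (by omega)

end WeakClosed

/-! ## §2 … hence by the trivial history's mass: NECESSITY of (a)′∀ -/
section Necessity

variable {P : Params} {G : Type} [GaugeGroup G] [MeasurableSpace G] [HaarData G] [RegularGaugeGroup G]
  (M₁ : ℕ) (Rcol : ℕ → ℕ) (εL εS : ℕ → ℝ) (av : ∀ j, Averaging P j G) (hav : ∀ j, AvgAC (av j).avg)
include hav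

/-- ★★★ **`(Ū_{k−1}∘⋯∘Ū_j)_*dU_j ≤ m_k(triv,·)·dU_k` FOR EVERY START LEVEL `j ≤ k`** (`k ≤ m + K + 1`): §1 at the least weakly-closed family `ν♯` (file 17 §4; it exists and is
weakly closed at every level) combined with file 28 §2's identity `dU_k + ν♯_k = m_k(triv,·)·dU_k`.  File 25's `T_{k−1}⋯T_0 1 ≤ m_k(triv,·)` is the case `j = 0`.
[cite: Balaban1985UV3, (2) p.256 + (41) p.266 + (47) p.267 (bookkeeping); Balaban1985Averaging, (10) p.19] -/
theorem partialIterates_le_withDensity_massRecAC_triv (ι : ∀ j k : ℕ, Measure (GaugeField P k G)) (hι0 : ∀ j, ι j j = fieldMeasure P j G)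
    (hιs : ∀ j k, j ≤ k → ι j (k + 1) = (ι j k).map (av k).avg) {k : ℕ} (hk : k ≤ P.m + P.K + 1) {j : ℕ} (hj : j ≤ k) :
    ι j k ≤ (fieldMeasure P k G).withDensity (fun V => ENNReal.ofReal (massRecAC M₁ Rcol εL εS av k (Hist.triv P k) V)) := by
  obtain ⟨νs, h0, hsucc⟩ := exists_excessRec av
  rw [withDensity_massRecAC_triv_eq_add_excessRec M₁ Rcol εL εS hav νs h0 hsucc k hk]
  exact partialIterates_le_add_of_weakClosed (fun j => (hav j).1) ι hι0 hιs k νs (fun i _ => weakClosed_of_excessRec νs h0 hsucc i) k le_rfl j hj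

/-- ★★★ **NECESSITY OF (a)′∀: the a.e. mass letter at the trivial history, `m_k(triv,·) ≤ e^{c}` `dU_k`-a.e., forces `(Ū_{k−1}∘⋯∘Ū_j)_*dU_j ≤ e^{c}·dU_k` for EVERY start level
`j ≤ k`** (`k ≤ m + K + 1`; §2 + `withDensity_mono`).  By file 28 §1 the letter at ANY family of histories containing `triv` — in particular III-b's uniform letter and files 23–24's
history-extensive letter — forces the same. [cite: Balaban1985UV3, (5) p.257 + (41) p.266 + (2) p.256 (bookkeeping); Balaban1985Averaging, (15) p.19] -/
theorem partialIterates_le_smul_of_massBound_triv (ι : ∀ j k : ℕ, Measure (GaugeField P k G)) (hι0 : ∀ j, ι j j = fieldMeasure P j G)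
    (hιs : ∀ j k, j ≤ k → ι j (k + 1) = (ι j k).map (av k).avg) {k : ℕ} (hk : k ≤ P.m + P.K + 1) (c : ℝ)
    (hm : ∀ᵐ V ∂(fieldMeasure P k G), massRecAC M₁ Rcol εL εS av k (Hist.triv P k) V ≤ Real.exp c) {j : ℕ} (hj : j ≤ k) :
    ι j k ≤ ENNReal.ofReal (Real.exp c) • fieldMeasure P k G := by
  rw [← withDensity_const]
  exact (partialIterates_le_withDensity_massRecAC_triv M₁ Rcol εL εS av hav ι hι0 hιs hk hj).trans
    (withDensity_mono (hm.mono fun V hV => ENNReal.ofReal_le_ofReal hV))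

/-- **… a.e. density form**: the letter at `triv` forces `dι_{j,k}∕dU_k ≤ e^{c}` `dU_k`-a.e. for every `j ≤ k` (file 16's comparison lemma). [cite: Balaban1985UV3, (5) p.257 + (2) p.256 (bookkeeping)] -/
theorem rnDeriv_partialIterates_le_ae_of_massBound_triv (ι : ∀ j k : ℕ, Measure (GaugeField P k G)) (hι0 : ∀ j, ι j j = fieldMeasure P j G)
    (hιs : ∀ j k, j ≤ k → ι j (k + 1) = (ι j k).map (av k).avg) {k : ℕ} (hk : k ≤ P.m + P.K + 1) (c : ℝ)
    (hm : ∀ᵐ V ∂(fieldMeasure P k G), massRecAC M₁ Rcol εL εS av k (Hist.triv P k) V ≤ Real.exp c) {j : ℕ} (hj : j ≤ k) :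
    ∀ᵐ V ∂(fieldMeasure P k G), (ι j k).rnDeriv (fieldMeasure P k G) V ≤ ENNReal.ofReal (Real.exp c) := by
  have h := partialIterates_le_smul_of_massBound_triv M₁ Rcol εL εS av hav ι hι0 hιs hk c hm hj
  rw [← withDensity_const] at h
  exact rnDeriv_le_of_le_withDensity h

/-! ## §3 The bracket closes through (a)′∀ -/

/-- ★★ **THE BRACKET, DISPLAYED**: if the letter holds at the trivial history at every level `k′ ≤ k` with profile `c` (`0 ≤ c`, `k ≤ m + K + 1`), then — passing ONLY through the
partial iterated push-forwards of Haar ((a)′∀ by §2, then file 27's sufficiency) — `m_k(h,·) ≤ (k+1)·e^{c_k}` `dU_k`-a.e. for every history `h`.  (File 28 §1 gives the sharper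
`≤ e^{c_k}` directly; the point displayed is that (a)′∀ carries the letter up to the factor `k + 1` and is implied by it: «letter ⟺ (a)′∀ modulo `log(k+1)`».)
[cite: Balaban1985UV3, (5) p.257 + (41) p.266 + (2) p.256 (bookkeeping); Balaban1985Averaging, (15) p.19] -/
theorem massRecAC_le_ae_of_massBound_triv_levels_via_partialIterates {k : ℕ} (hk : k ≤ P.m + P.K + 1) (c : ℕ → ℝ) (hc : ∀ i, 0 ≤ c i)
    (hm : ∀ i, i ≤ k → ∀ᵐ V ∂(fieldMeasure P i G), massRecAC M₁ Rcol εL εS av i (Hist.triv P i) V ≤ Real.exp (c i)) (h : Hist P k) :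
    ∀ᵐ V ∂(fieldMeasure P k G), massRecAC M₁ Rcol εL εS av k h V ≤ (k + 1) * Real.exp (c k) := by
  obtain ⟨ι, hι0, hιs⟩ := exists_partialIterates av
  exact massRecAC_le_exp_mul_ae_of_partialIterates_le M₁ Rcol εL εS av hav ι hι0 hιs k c hc
    (fun j i hji hik => partialIterates_le_smul_of_massBound_triv M₁ Rcol εL εS av hav ι hι0 hιs (by omega) (c i) (hm i hik) hji.le) k le_rfl h

omit [RegularGaugeGroup G] in
/-- ★ **THE `log(k+1)` DEFECT IS ABSORBED BY ANY SLACK `δ_k ≥ log(k+1)` IN THE EXPONENT**: (a)′∀ with profile `c` (`ι_{j,k′} ≤ e^{c_{k′}}·dU_{k′}`, `j < k′ ≤ K̄`) ⇒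
`m_k(h,·) ≤ e^{c_k + δ_k}` a.e. for every history whenever `log(k+1) ≤ δ_k` (file 27 + `(k+1)·e^{c} = e^{c + log(k+1)}`).  At the [B10] slot `c_k = c_m|T₁^{(k)}|` and one may take
`δ_k = c″|T₁^{(k)}|` as long as `log(k+1) ≤ c″|T₁^{(k)}|` — true except at the top `O(log log K)` levels, where the coarse lattice has `O(1)` sites (there the floored-iterate form (F)
of file 28 is the honest statement). [cite: Balaban1985UV3, (5) p.257 + (41) p.266 (bookkeeping); Balaban1985Averaging, (15) p.19] -/
theorem massRecAC_le_exp_ae_of_partialIterates_le_of_log_le (ι : ∀ j k : ℕ, Measure (GaugeField P k G)) (hι0 : ∀ j, ι j j = fieldMeasure P j G)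
    (hιs : ∀ j k, j ≤ k → ι j (k + 1) = (ι j k).map (av k).avg) (Kt : ℕ) (c δ : ℕ → ℝ) (hc : ∀ k, 0 ≤ c k)
    (hbound : ∀ j k, j < k → k ≤ Kt → ι j k ≤ ENNReal.ofReal (Real.exp (c k)) • fieldMeasure P k G)
    (k : ℕ) (hk : k ≤ Kt) (hlog : Real.log (k + 1) ≤ δ k) (h : Hist P k) :
    ∀ᵐ V ∂(fieldMeasure P k G), massRecAC M₁ Rcol εL εS av k h V ≤ Real.exp (c k + δ k) := by
  filter_upwards [massRecAC_le_exp_mul_ae_of_partialIterates_le M₁ Rcol εL εS av hav ι hι0 hιs Kt c hc hbound k hk h] with V hV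
  have hk1 : (0 : ℝ) < k + 1 := by positivity
  have h1 : ((k : ℝ) + 1) * Real.exp (c k) = Real.exp (c k + Real.log (k + 1)) := by
    rw [Real.exp_add, Real.exp_log hk1, mul_comm]
  calc massRecAC M₁ Rcol εL εS av k h V ≤ (k + 1) * Real.exp (c k) := hV
    _ = Real.exp (c k + Real.log (k + 1)) := h1
    _ ≤ Real.exp (c k + δ k) := Real.exp_le_exp.2 (by linarith)

end Necessity

/-! ## §4 At the [B10] slot's averaging -/
section Print

open Literature.MathematicalPhysics.QuantumFieldTheory.Balaban1985CMP102.Setting (Scales)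
open Literature.MathematicalPhysics.QuantumFieldTheory.Balaban1983to89.B10RunsOfRecord (avOfPrint)
open Literature.MathematicalPhysics.QuantumFieldTheory.Balaban1983to89.Node00 (SU)
open Summit.QuantumFields.YangMills.BalabanUVNodes.N08Thm2AtRecordBridgeInhabited (avgAC_avOfPrint)

variable (N : ℕ) [NeZero N] {L : ℕ} (S : Scales L) (M₁ : ℕ) (Rcol : ℕ → ℕ) (εL εS : ℕ → ℝ)

/-- ★★ **AT PRINT'S AVERAGING ON `SU(N)`: `(Ū_{k−1}∘⋯∘Ū_j)_*dU_j ≤ m_k(triv,·)·dU_k`** for every `j ≤ k ≤ K + 1`, the `Ū_i` the averagings of [Balaban1985Averaging] (15) (`avOfPrint N S`),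
`m` print's iterated Radon–Nikodym masses, any thresholds. [cite: Balaban1985UV3, (2) p.256 + (41) p.266 + (47) p.267; Balaban1985Averaging, (15) p.19] -/
theorem partialIterates_avOfPrint_le_withDensity_triv (ι : ∀ j k : ℕ, Measure (GaugeField S.P k (SU N)))
    (hι0 : ∀ j, ι j j = fieldMeasure S.P j (SU N)) (hιs : ∀ j k, j ≤ k → ι j (k + 1) = (ι j k).map (avOfPrint N S k).avg)
    {k : ℕ} (hk : k ≤ S.K + 1) {j : ℕ} (hj : j ≤ k) :
    ι j k ≤ (fieldMeasure S.P k (SU N)).withDensity (fun V => ENNReal.ofReal (massRecAC M₁ Rcol εL εS (avOfPrint N S) k (Hist.triv S.P k) V)) :=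
  partialIterates_le_withDensity_massRecAC_triv M₁ Rcol εL εS (avOfPrint N S) (avgAC_avOfPrint N L S) ι hι0 hιs (by show k ≤ S.m + S.K + 1; omega) hj

/-- ★★★ **AT PRINT'S AVERAGING: THE SLOT'S MASS LETTER FORCES (a)′∀** — if «`massRecAC M₁ Rcol ε_L ε_S (avOfPrint N S) k (Hist.triv) ≤ e^{c_m|T₁^{(k)}|}` `dU_k`-a.e.» at a level
`k ≤ K + 1` (the transport antecedent of file 29 §2; implied by III-b's and file 24's), then **`(Ū_{k−1}∘⋯∘Ū_j)_*dU_j ≤ e^{c_m|T₁^{(k)}|}·dU_k` for EVERY start level `j ≤ k`**: the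
`k`-uniform extensive bound on ALL partial iterated push-forwards of Haar under (15) is NECESSARY. [cite: Balaban1985UV3, (5) p.257 + (2) p.256 + (41) p.266; Balaban1985Averaging, (15) p.19] -/
theorem partialIterates_avOfPrint_le_smul_of_massBound_triv (ι : ∀ j k : ℕ, Measure (GaugeField S.P k (SU N)))
    (hι0 : ∀ j, ι j j = fieldMeasure S.P j (SU N)) (hιs : ∀ j k, j ≤ k → ι j (k + 1) = (ι j k).map (avOfPrint N S k).avg)
    {k : ℕ} (hk : k ≤ S.K + 1) (cm : ℝ)
    (hm : ∀ᵐ V ∂(fieldMeasure S.P k (SU N)), massRecAC M₁ Rcol εL εS (avOfPrint N S) k (Hist.triv S.P k) V ≤ Real.exp (cm * S.sites k)) {j : ℕ} (hj : j ≤ k) :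
    ι j k ≤ ENNReal.ofReal (Real.exp (cm * S.sites k)) • fieldMeasure S.P k (SU N) :=
  partialIterates_le_smul_of_massBound_triv M₁ Rcol εL εS (avOfPrint N S) (avgAC_avOfPrint N L S) ι hι0 hιs (by show k ≤ S.m + S.K + 1; omega) _ hm hj

/-- ★★ **AT PRINT'S AVERAGING, (a)′∀ ⇒ THE LETTER WITH SLACK `c″`**: if all partial iterated push-forwards of Haar under (15) obey `(Ū_{k−1}∘⋯∘Ū_j)_*dU_j ≤ e^{c_m|T₁^{(k)}|}·dU_k`
(`j < k ≤ K`) and `log(k+1) ≤ c″|T₁^{(k)}|`, then «`massRecAC M₁ Rcol ε_L ε_S (avOfPrint N S) k h ≤ e^{(c_m + c″)|T₁^{(k)}|}` `dU_k`-a.e.» for every history — III-b's ∕ file 29's antecedent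
with constant `c_m + c″` (file 27 at print's averaging + the slack). [cite: Balaban1985UV3, (5) p.257 + (41) p.266; Balaban1985Averaging, (15) p.19] -/
theorem massRecAC_avOfPrint_le_exp_ae_of_partialIterates_le_of_log_le (ι : ∀ j k : ℕ, Measure (GaugeField S.P k (SU N)))
    (hι0 : ∀ j, ι j j = fieldMeasure S.P j (SU N)) (hιs : ∀ j k, j ≤ k → ι j (k + 1) = (ι j k).map (avOfPrint N S k).avg) {cm c'' : ℝ} (hcm : 0 ≤ cm)
    (hbound : ∀ j k, j < k → k ≤ S.K → ι j k ≤ ENNReal.ofReal (Real.exp (cm * S.sites k)) • fieldMeasure S.P k (SU N))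
    (k : ℕ) (hk : k ≤ S.K) (hlog : Real.log (k + 1) ≤ c'' * S.sites k) (h : Hist S.P k) :
    ∀ᵐ V ∂(fieldMeasure S.P k (SU N)), massRecAC M₁ Rcol εL εS (avOfPrint N S) k h V ≤ Real.exp ((cm + c'') * S.sites k) := by
  have := massRecAC_le_exp_ae_of_partialIterates_le_of_log_le M₁ Rcol εL εS (avOfPrint N S) (avgAC_avOfPrint N L S) ι hι0 hιs S.K
    (fun k => cm * S.sites k) (fun k => c'' * S.sites k) (fun k => mul_nonneg hcm (Summit.QuantumFields.Balaban3D.Proofs.ScalesArithmetic.sites_nonneg S k))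
    hbound k hk hlog h
  simpa only [add_mul] using this

end Print

end Summit.QuantumFields.YangMills.BalabanUVNodes.N08PartialIteratesNecessity

end
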